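import Literature.NumberTheory.Weil1964.ArchMetaplecticDoubleCover
import Literature.NumberTheory.Weil1964.ArchWeilDatumTensor
import HarnessLib

/-!
# The metaplectic group of the Schwartz model over an orthogonal direct sum: `Mp^𝓢(W₁) × Mp^𝓢(W₂) → Mp^𝓢(W₁ ⊕ W₂)` and Folland's normalisation

Topic `NumberTheory/Weil1964`; namespace `Literature.NumberTheory.Weil1964`.  Continuation of
`Literature.NumberTheory.Weil1964.ArchMetaplecticDoubleCover` (the group `Mp^𝓢(W)` = `MpS σ` of Heisenberg-covariant
topological automorphisms of `𝓢(ℝ^σ)` with unitary `L²`-lifts over weil-1's `Sp(W)`, `W = ℝ^σ × ℝ^σ`; Folland's block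
`P(g)` = `Sp.follandP`, the vacuum coefficient `C(x)` = `MpS.vac`, and Folland's normalisation
`MpS.IsMetaplectic x : C(x)² · det P(proj x) = 1` cutting out the metaplectic double cover) and of
`Literature.NumberTheory.Weil1964.ArchWeilDatumTensor` (the block sum `spBlock : Sp(W₁) × Sp(W₂) →* Sp(W₁ ⊕ W₂)` for
`W_j = ℝ^{σ_j} × ℝ^{σ_j}` and the CONSTRUCTED operator tensor product `A₁ ⊠̂ A₂ = tensorOp A₁ A₂` on `𝓢(ℝ^{σ₁ ⊕ σ₂})`,
Heisenberg-covariant over `spBlock` and `L²`-isometric when the factors are).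

WHAT IS PROVED (kernel only; no record, no `sorry`):

* §1 `MpS.tensor x₁ x₂ : Mp^𝓢(W₁ ⊕ W₂)` — the element `(proj x₁ ⊕ proj x₂, x₁ ⊠̂ x₂)`; it is a HOMOMORPHISM in the
  pair (`MpS.tensorHom`, `tensor_mul`, `tensor_one`), lies over `spBlock` (`proj_tensor`), acts on pure tensors
  factor by factor (`tensor_apply_tensorPi`), and `(c·x₁) ⊠ x₂ = c·(x₁ ⊠ x₂)`, in particular
  `(−x₁) ⊠ x₂ = x₁ ⊠ (−x₂) = −(x₁ ⊠ x₂)` and `(−x₁) ⊠ (−x₂) = x₁ ⊠ x₂` — "the standard representation of `G₁ × G₂` is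
  the tensor product of the standard representations" [Weil1964, Chap. I n° 12] for the Schwartz model, and the map
  `Mp(W₁) × Mp(W₂) → Mp(W₁ ⊕ W₂)` of [MoeglinVignerasWaldspurger1987, Chap. 2 II.1 (6)] / [Kudla1984, §1];
* §2 the VACUUM COEFFICIENT IS MULTIPLICATIVE: `C(x₁ ⊠ x₂) = C(x₁) · C(x₂)` (`vac_tensor`; the Gaussian of
  `ℝ^{σ₁ ⊕ σ₂}` is the pure tensor of the two Gaussians, `hermitePi_zero_eq_tensorPi`, and Fubini
  `⟪f ⊠ g, f' ⊠ g'⟫ = ⟪f, f'⟫⟪g, g'⟫`);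
* §3 FOLLAND'S BLOCK IS BLOCK-DIAGONAL: `P(g₁ ⊕ g₂) = P(g₁) ⊕ P(g₂)` (`Sp.follandP_spBlock`, as `Matrix.fromBlocks`),
  hence `det P(g₁ ⊕ g₂) = det P(g₁) det P(g₂)`;
* §4 FOLLAND'S NORMALISATION IS MULTIPLICATIVE: `x₁, x₂` metaplectic ⟹ `x₁ ⊠ x₂` metaplectic
  (`MpS.IsMetaplectic.tensor`), and conversely a metaplectic element over `proj x₁ ⊕ proj x₂` is `±(x₁ ⊠ x₂)`
  (`IsMetaplectic.eq_tensor_or`); so the metaplectic double cover of `Sp(W₁ ⊕ W₂)` restricted to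
  `Sp(W₁) × Sp(W₂)` is the quotient of `Mp₂(W₁) × Mp₂(W₂)` by the diagonal `{(1,1), (−1,−1)}` — used by the
  pub-hodgecm2 literature fan-out row B08-2 (b) (Paul 1998 (1.2.1): the dual-pair embedding
  `ι_V : U(V) → Sp(V ⊗ W)` is a block sum over an orthogonal basis of `W`);
* §5 the DIAGONAL: the tensor square `x ⊠ x` depends only on `±x` (`tensor_negOne_mul_self`), so over `g ⊕ g` the
  metaplectic cover has the CANONICAL point `x ⊠ x` (`x` either metaplectic element over `g`), multiplicative in `g`
  up to nothing (`tensorSq_mul_of`): the restriction of the metaplectic cover to the diagonal `Sp(W) → Sp(W ⊕ W)`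
  SPLITS canonically.

Dictionary with print.  [Weil1964, Chap. I n° 12, p. 160]: for `G = G₁ × G₂` … «la représentation standard de
`A(G)` … est le produit tensoriel des représentations standard»; [Folland1989, Prop. (1.43)] (tensor products of the
Schrödinger representation), (4.23) (implementers); [MoeglinVignerasWaldspurger1987, Chap. 2 II.1] (the metaplectic
group as pairs `(g, M)`; (6): `W = W₁ ⊕ W₂` orthogonal gives `Mp(W₁) × Mp(W₂) → Mp(W)`); [Kudla1984, §1] (seesaw pairs
live on such block sums).  The block-diagonal form of `P` is (4.11)–(4.16) of [Folland1989] applied blockwise.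
Everything here is PROVED; citations record provenance only.

## References

* [Weil1964] A. Weil, *Sur certains groupes d'opérateurs unitaires*, Acta Math. 111 (1964) 143–211, Chap. I n° 12.
* [Folland1989] G. B. Folland, *Harmonic Analysis in Phase Space*, Princeton UP 1989, Prop. (1.43), §4.1 (4.11)–(4.16),
  §4.2 (4.23), Thm. (4.37).
* [MoeglinVignerasWaldspurger1987] C. Mœglin, M.-F. Vignéras, J.-L. Waldspurger, *Correspondances de Howe sur un corps
  p-adique*, LNM 1291 (1987), Chap. 2 II.1.
* [Kudla1984] S. Kudla, *Seesaw dual reductive pairs*, Progr. Math. 46 (1984) 244–268, §1.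
-/

set_option autoImplicit false

noncomputable section

open MeasureTheory Complex SchwartzMap
open scoped InnerProductSpace ComplexConjugate Real

namespace Literature.NumberTheory.Weil1964

open Literature.Analysis.SegalBargmann Literature.RepresentationTheory.HeisenbergGroup

variable {σ₁ σ₂ : Type*} [Fintype σ₁] [DecidableEq σ₁] [Fintype σ₂] [DecidableEq σ₂]

local notation "L2R" σ => Lp ℂ 2 (volume : Measure (σ → ℝ))
local notation "SR" σ => SchwartzMap (σ → ℝ) ℂ
local notation "PV" σ => (σ → ℝ) × (σ → ℝ)
local notation "SpR" σ => symplecticGroup (polar (dotPairing σ))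

/-! ## 0. Two small facts on pure tensors and on `⊠̂` -/

/-- **The Gaussian of `ℝ^{σ₁ ⊕ σ₂}` is the pure tensor of the two Gaussians**: `h_0 = h_0 ⊠ h_0`.
[cite: Folland1989, §1.7] -/
theorem hermitePi_zero_eq_tensorPi :
    (hermitePi (0 : σ₁ ⊕ σ₂ →₀ ℕ) : SR (σ₁ ⊕ σ₂)) = tensorPi (hermitePi (0 : σ₁ →₀ ℕ)) (hermitePi (0 : σ₂ →₀ ℕ)) := by
  rw [hermitePi_eq_tensorPi, Finsupp.comapDomain_zero, Finsupp.comapDomain_zero]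

/-- `(c • A₁) ⊠̂ A₂ = c • (A₁ ⊠̂ A₂)` (bilinearity of the operator tensor product). [cite: Folland1989, Prop. (1.43), §1.7] -/
theorem tensorOp_smul_left (c : ℂ) (A₁ : (SR σ₁) →L[ℂ] SR σ₁) (A₂ : (SR σ₂) →L[ℂ] SR σ₂) :
    tensorOp (c • A₁) A₂ = c • tensorOp A₁ A₂ :=
  (eq_tensorOp_of_apply_tensorPi (A₁ := c • A₁) (A₂ := A₂) (T := c • tensorOp A₁ A₂) fun f g => by
    show c • tensorOp A₁ A₂ (tensorPi f g) = tensorPi (c • A₁ f) (A₂ g)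
    rw [tensorOp_tensorPi, tensorPi_smul_left]).symm

/-- `A₁ ⊠̂ (c • A₂) = c • (A₁ ⊠̂ A₂)` (bilinearity of the operator tensor product). [cite: Folland1989, Prop. (1.43), §1.7] -/
theorem tensorOp_smul_right (c : ℂ) (A₁ : (SR σ₁) →L[ℂ] SR σ₁) (A₂ : (SR σ₂) →L[ℂ] SR σ₂) :
    tensorOp A₁ (c • A₂) = c • tensorOp A₁ A₂ :=
  (eq_tensorOp_of_apply_tensorPi (A₁ := A₁) (A₂ := c • A₂) (T := c • tensorOp A₁ A₂) fun f g => by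
    show c • tensorOp A₁ A₂ (tensorPi f g) = tensorPi (A₁ f) (c • A₂ g)
    rw [tensorOp_tensorPi, tensorPi_smul_right]).symm

/-! ## 1. The tensor product of two elements of `Mp^𝓢` -/

namespace MpS

/-- The tensor product `S₁ ⊠̂ S₂` of two topological automorphisms of `𝓢(ℝ^{σ₁})`, `𝓢(ℝ^{σ₂})`, as a topological
automorphism of `𝓢(ℝ^{σ₁ ⊕ σ₂})` (inverse `S₁⁻¹ ⊠̂ S₂⁻¹`, by functoriality of `⊠̂`). [cite: Folland1989, Prop. (1.43)] -/
def tensorEquiv (S₁ : (SR σ₁) ≃L[ℂ] SR σ₁) (S₂ : (SR σ₂) ≃L[ℂ] SR σ₂) : (SR (σ₁ ⊕ σ₂)) ≃L[ℂ] SR (σ₁ ⊕ σ₂) :=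
  ContinuousLinearEquiv.equivOfInverse
    (tensorOp (S₁ : (SR σ₁) →L[ℂ] SR σ₁) (S₂ : (SR σ₂) →L[ℂ] SR σ₂))
    (tensorOp (S₁.symm : (SR σ₁) →L[ℂ] SR σ₁) (S₂.symm : (SR σ₂) →L[ℂ] SR σ₂))
    (fun F => by
      have h := congrArg (fun T : (SR (σ₁ ⊕ σ₂)) →L[ℂ] SR (σ₁ ⊕ σ₂) => T F)
        (tensorOp_comp (S₁.symm : (SR σ₁) →L[ℂ] SR σ₁) (S₁ : (SR σ₁) →L[ℂ] SR σ₁)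
          (S₂.symm : (SR σ₂) →L[ℂ] SR σ₂) (S₂ : (SR σ₂) →L[ℂ] SR σ₂))
      simp only [ContinuousLinearMap.comp_apply, ContinuousLinearEquiv.coe_symm_comp_coe, tensorOp_id,
        ContinuousLinearMap.id_apply] at h
      exact h)
    (fun F => by
      have h := congrArg (fun T : (SR (σ₁ ⊕ σ₂)) →L[ℂ] SR (σ₁ ⊕ σ₂) => T F)
        (tensorOp_comp (S₁ : (SR σ₁) →L[ℂ] SR σ₁) (S₁.symm : (SR σ₁) →L[ℂ] SR σ₁)
          (S₂ : (SR σ₂) →L[ℂ] SR σ₂) (S₂.symm : (SR σ₂) →L[ℂ] SR σ₂))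
      simp only [ContinuousLinearMap.comp_apply, ContinuousLinearEquiv.coe_comp_coe_symm, tensorOp_id,
        ContinuousLinearMap.id_apply] at h
      exact h)

/-- `tensorEquiv S₁ S₂` acts as `S₁ ⊠̂ S₂`. [cite: Folland1989, Prop. (1.43)] -/
@[simp] theorem tensorEquiv_apply (S₁ : (SR σ₁) ≃L[ℂ] SR σ₁) (S₂ : (SR σ₂) ≃L[ℂ] SR σ₂) (F : SR (σ₁ ⊕ σ₂)) :
    tensorEquiv S₁ S₂ F = tensorOp (S₁ : (SR σ₁) →L[ℂ] SR σ₁) (S₂ : (SR σ₂) →L[ℂ] SR σ₂) F := rfl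

/-- `tensorEquiv S₁ S₂` as a continuous linear map is `S₁ ⊠̂ S₂`. [cite: Folland1989, Prop. (1.43)] -/
theorem coe_tensorEquiv (S₁ : (SR σ₁) ≃L[ℂ] SR σ₁) (S₂ : (SR σ₂) ≃L[ℂ] SR σ₂) :
    (tensorEquiv S₁ S₂ : (SR (σ₁ ⊕ σ₂)) →L[ℂ] SR (σ₁ ⊕ σ₂)) =
      tensorOp (S₁ : (SR σ₁) →L[ℂ] SR σ₁) (S₂ : (SR σ₂) →L[ℂ] SR σ₂) := rfl

/-- **The tensor product `x₁ ⊠ x₂ ∈ Mp^𝓢(W₁ ⊕ W₂)` of `x_j ∈ Mp^𝓢(W_j)`**: the pair `(proj x₁ ⊕ proj x₂, x₁ ⊠̂ x₂)` — the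
operator tensor product is Heisenberg-covariant over the block sum (`tensorOp_rhoS`) and is the restriction of a unitary
of `L²(ℝ^{σ₁ ⊕ σ₂})` (`norm_toL2_tensorOp` + extension along the dense `toL2`).
[cite: Weil1964, Chap. I n° 12, p. 160; MoeglinVignerasWaldspurger1987, Chap. 2 II.1 (6); Folland1989, Prop. (1.43), (4.23)] -/
def tensor (x₁ : MpS σ₁) (x₂ : MpS σ₂) : MpS (σ₁ ⊕ σ₂) :=
  ⟨(spBlock (proj x₁, proj x₂), tensorEquiv x₁.1.2 x₂.1.2), (mem_iff_covariant _).2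
    ⟨fun P Q F => tensorOp_rhoS (s₁ := ⇑((proj x₁ : SpR σ₁) : (PV σ₁) ≃ₗ[ℝ] PV σ₁))
        (s₂ := ⇑((proj x₂ : SpR σ₂) : (PV σ₂) ≃ₗ[ℝ] PV σ₂)) _ _
        ((mem_iff_covariant x₁.1).1 x₁.2).1 ((mem_iff_covariant x₂.1).1 x₂.2).1 P Q F,
      exists_unitary_liftsTo (tensorEquiv x₁.1.2 x₂.1.2) fun F => norm_toL2_tensorOp x₁.2.2 x₂.2.2 F⟩⟩

/-- `x₁ ⊠ x₂` lies over the block sum `proj x₁ ⊕ proj x₂`. [cite: MoeglinVignerasWaldspurger1987, Chap. 2 II.1 (6)] -/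
@[simp] theorem proj_tensor (x₁ : MpS σ₁) (x₂ : MpS σ₂) : proj (tensor x₁ x₂) = spBlock (proj x₁, proj x₂) := rfl

/-- `x₁ ⊠ x₂` acts by `x₁ ⊠̂ x₂`. [cite: Weil1964, Chap. I n° 12, p. 160] -/
theorem tensor_apply (x₁ : MpS σ₁) (x₂ : MpS σ₂) (F : SR (σ₁ ⊕ σ₂)) :
    (tensor x₁ x₂).1.2 F = tensorOp (x₁.1.2 : (SR σ₁) →L[ℂ] SR σ₁) (x₂.1.2 : (SR σ₂) →L[ℂ] SR σ₂) F := rfl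

/-- the operator of `x₁ ⊠ x₂` as a continuous linear map. [cite: Weil1964, Chap. I n° 12, p. 160] -/
theorem coe_tensor (x₁ : MpS σ₁) (x₂ : MpS σ₂) :
    ((tensor x₁ x₂).1.2 : (SR (σ₁ ⊕ σ₂)) →L[ℂ] SR (σ₁ ⊕ σ₂)) =
      tensorOp (x₁.1.2 : (SR σ₁) →L[ℂ] SR σ₁) (x₂.1.2 : (SR σ₂) →L[ℂ] SR σ₂) := rfl

/-- **`(x₁ ⊠ x₂)(f ⊠ g) = x₁ f ⊠ x₂ g`.** [cite: Weil1964, Chap. I n° 12, p. 160; Folland1989, Prop. (1.43)] -/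
@[simp] theorem tensor_apply_tensorPi (x₁ : MpS σ₁) (x₂ : MpS σ₂) (f : SR σ₁) (g : SR σ₂) :
    (tensor x₁ x₂).1.2 (tensorPi f g) = tensorPi (x₁.1.2 f) (x₂.1.2 g) :=
  tensorOp_tensorPi _ _ f g

/-- `1 ⊠ 1 = 1`. [cite: Weil1964, Chap. I n° 12, p. 160] -/
@[simp] theorem tensor_one : tensor (1 : MpS σ₁) (1 : MpS σ₂) = 1 :=
  ext' (by rw [proj_tensor, map_one, map_one, map_one]; exact map_one spBlock) fun F => by
    rw [tensor_apply]
    exact congrArg (fun T : (SR (σ₁ ⊕ σ₂)) →L[ℂ] SR (σ₁ ⊕ σ₂) => T F) tensorOp_id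

/-- **`⊠` is multiplicative**: `(x₁ y₁) ⊠ (x₂ y₂) = (x₁ ⊠ x₂)(y₁ ⊠ y₂)`. [cite: Weil1964, Chap. I n° 12, p. 160; MoeglinVignerasWaldspurger1987, Chap. 2 II.1 (6)] -/
theorem tensor_mul (x₁ y₁ : MpS σ₁) (x₂ y₂ : MpS σ₂) :
    tensor (x₁ * y₁) (x₂ * y₂) = tensor x₁ x₂ * tensor y₁ y₂ :=
  ext' (by rw [map_mul proj, proj_tensor, proj_tensor, proj_tensor, ← map_mul spBlock, Prod.mk_mul_mk, map_mul proj,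
      map_mul proj]) fun F => by
      rw [mul_apply, tensor_apply, tensor_apply, tensor_apply]
      have h := congrArg (fun T : (SR (σ₁ ⊕ σ₂)) →L[ℂ] SR (σ₁ ⊕ σ₂) => T F)
        (tensorOp_comp (x₁.1.2 : (SR σ₁) →L[ℂ] SR σ₁) (y₁.1.2 : (SR σ₁) →L[ℂ] SR σ₁)
          (x₂.1.2 : (SR σ₂) →L[ℂ] SR σ₂) (y₂.1.2 : (SR σ₂) →L[ℂ] SR σ₂))
      simp only [ContinuousLinearMap.comp_apply] at h
      exact h.symm

/-- **`Mp^𝓢(W₁) × Mp^𝓢(W₂) →* Mp^𝓢(W₁ ⊕ W₂)`, `(x₁, x₂) ↦ x₁ ⊠ x₂`.**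
[cite: MoeglinVignerasWaldspurger1987, Chap. 2 II.1 (6); Weil1964, Chap. I n° 12, p. 160] -/
def tensorHom : MpS σ₁ × MpS σ₂ →* MpS (σ₁ ⊕ σ₂) where
  toFun x := tensor x.1 x.2
  map_one' := tensor_one
  map_mul' x y := tensor_mul x.1 y.1 x.2 y.2

/-- Unfolding of `tensorHom`: `(x₁, x₂) ↦ x₁ ⊠ x₂`. [cite: MoeglinVignerasWaldspurger1987, Chap. 2 II.1 (6)] -/
@[simp] theorem tensorHom_apply (x : MpS σ₁ × MpS σ₂) : tensorHom x = tensor x.1 x.2 := rfl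

/-- `proj ∘ tensorHom = spBlock ∘ (proj × proj)`. [cite: MoeglinVignerasWaldspurger1987, Chap. 2 II.1 (6)] -/
theorem proj_comp_tensorHom :
    (proj (σ := σ₁ ⊕ σ₂)).comp tensorHom = spBlock.comp ((proj (σ := σ₁)).prodMap (proj (σ := σ₂))) := rfl

/-- `(x₁ ⊠ x₂)⁻¹ = x₁⁻¹ ⊠ x₂⁻¹`. [cite: MoeglinVignerasWaldspurger1987, Chap. 2 II.1 (6)] -/
theorem tensor_inv (x₁ : MpS σ₁) (x₂ : MpS σ₂) : tensor x₁⁻¹ x₂⁻¹ = (tensor x₁ x₂)⁻¹ :=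
  map_inv tensorHom (x₁, x₂)

/-- **Scalars pull out on the left**: if `y₁ = c · x₁` as operators then `y₁ ⊠ x₂ = c · (x₁ ⊠ x₂)` as operators.
[cite: Folland1989, Prop. (1.43)] -/
theorem tensor_apply_of_smul_left {x₁ y₁ : MpS σ₁} {c : ℂ} (h : ∀ f : SR σ₁, y₁.1.2 f = c • x₁.1.2 f) (x₂ : MpS σ₂)
    (F : SR (σ₁ ⊕ σ₂)) : (tensor y₁ x₂).1.2 F = c • (tensor x₁ x₂).1.2 F := by
  have hy : (y₁.1.2 : (SR σ₁) →L[ℂ] SR σ₁) = c • (x₁.1.2 : (SR σ₁) →L[ℂ] SR σ₁) :=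
    ContinuousLinearMap.ext fun f => h f
  rw [tensor_apply, tensor_apply, hy, tensorOp_smul_left]
  rfl

/-- **Scalars pull out on the right**: if `y₂ = c · x₂` as operators then `x₁ ⊠ y₂ = c · (x₁ ⊠ x₂)` as operators.
[cite: Folland1989, Prop. (1.43)] -/
theorem tensor_apply_of_smul_right (x₁ : MpS σ₁) {x₂ y₂ : MpS σ₂} {c : ℂ} (h : ∀ g : SR σ₂, y₂.1.2 g = c • x₂.1.2 g)
    (F : SR (σ₁ ⊕ σ₂)) : (tensor x₁ y₂).1.2 F = c • (tensor x₁ x₂).1.2 F := by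
  have hy : (y₂.1.2 : (SR σ₂) →L[ℂ] SR σ₂) = c • (x₂.1.2 : (SR σ₂) →L[ℂ] SR σ₂) :=
    ContinuousLinearMap.ext fun g => h g
  rw [tensor_apply, tensor_apply, hy, tensorOp_smul_right]
  rfl

/-- `(−x₁) ⊠ x₂ = −(x₁ ⊠ x₂)`. [cite: MoeglinVignerasWaldspurger1987, Chap. 2 II.1 (6)] -/
theorem tensor_negOne_mul_left (x₁ : MpS σ₁) (x₂ : MpS σ₂) :
    tensor (negOne * x₁) x₂ = negOne * tensor x₁ x₂ :=
  ext' (by rw [proj_tensor, map_mul, map_mul, proj_tensor, proj_negOne, proj_negOne, one_mul, one_mul]) fun F => by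
    rw [tensor_apply_of_smul_left (x₁ := x₁) (c := -1) (fun f => by rw [mul_apply, negOne_apply, neg_one_smul]) x₂ F,
      mul_apply, negOne_apply, neg_one_smul]

/-- `x₁ ⊠ (−x₂) = −(x₁ ⊠ x₂)`. [cite: MoeglinVignerasWaldspurger1987, Chap. 2 II.1 (6)] -/
theorem tensor_negOne_mul_right (x₁ : MpS σ₁) (x₂ : MpS σ₂) :
    tensor x₁ (negOne * x₂) = negOne * tensor x₁ x₂ :=
  ext' (by rw [proj_tensor, map_mul, map_mul, proj_tensor, proj_negOne, proj_negOne, one_mul, one_mul]) fun F => by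
    rw [tensor_apply_of_smul_right x₁ (x₂ := x₂) (c := -1) (fun g => by rw [mul_apply, negOne_apply, neg_one_smul]) F,
      mul_apply, negOne_apply, neg_one_smul]

/-- **`(−x₁) ⊠ (−x₂) = x₁ ⊠ x₂`**: the kernel of `Mp₂(W₁) × Mp₂(W₂) → Mp₂(W₁ ⊕ W₂)` contains the diagonal `(−1, −1)`.
[cite: MoeglinVignerasWaldspurger1987, Chap. 2 II.1 (6)] -/
theorem tensor_negOne_mul_negOne_mul (x₁ : MpS σ₁) (x₂ : MpS σ₂) :
    tensor (negOne * x₁) (negOne * x₂) = tensor x₁ x₂ := by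
  rw [tensor_negOne_mul_left, tensor_negOne_mul_right, ← mul_assoc, negOne_mul_negOne, one_mul]

/-- `(−1) ⊠ 1 = −1`. [cite: MoeglinVignerasWaldspurger1987, Chap. 2 II.1 (6)] -/
theorem tensor_negOne_one : tensor (negOne : MpS σ₁) (1 : MpS σ₂) = negOne := by
  have h := tensor_negOne_mul_left (1 : MpS σ₁) (1 : MpS σ₂)
  rwa [mul_one, tensor_one, mul_one] at h

/-- `1 ⊠ (−1) = −1`. [cite: MoeglinVignerasWaldspurger1987, Chap. 2 II.1 (6)] -/
theorem tensor_one_negOne : tensor (1 : MpS σ₁) (negOne : MpS σ₂) = negOne := by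
  have h := tensor_negOne_mul_right (1 : MpS σ₁) (1 : MpS σ₂)
  rwa [mul_one, tensor_one, mul_one] at h

/-! ## 2. The vacuum coefficient is multiplicative -/

/-- **`C(x₁ ⊠ x₂) = C(x₁) C(x₂)`**: the Gaussian of `ℝ^{σ₁ ⊕ σ₂}` is `k₀ ⊠ k₀` and `⟪f ⊠ g, f' ⊠ g'⟫ = ⟪f, f'⟫⟪g, g'⟫`.
[cite: Folland1989, Prop. (1.43), §4.2 (4.36)] -/
theorem vac_tensor (x₁ : MpS σ₁) (x₂ : MpS σ₂) : vac (tensor x₁ x₂) = vac x₁ * vac x₂ := by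
  rw [vac_apply, vac_apply, vac_apply, ← toL2_hermitePi_zero, ← toL2_hermitePi_zero, ← toL2_hermitePi_zero,
    hermitePi_zero_eq_tensorPi, tensor_apply_tensorPi, inner_toL2_tensorPi]

/-! ## 3. Folland's block `P` over a block sum -/

end MpS

namespace Sp

omit [DecidableEq σ₁] [DecidableEq σ₂] in
/-- `g₁ ⊕ g₂` on a vector supported in the first summand. [folklore] -/
private theorem spBlock_apply_inl (g : (SpR σ₁) × (SpR σ₂)) (p q : σ₁ → ℝ) :
    ((spBlock g : SpR (σ₁ ⊕ σ₂)) : (PV (σ₁ ⊕ σ₂)) ≃ₗ[ℝ] PV (σ₁ ⊕ σ₂)) (Sum.elim p 0, Sum.elim q 0) =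
      (Sum.elim ((g.1 : (PV σ₁) ≃ₗ[ℝ] PV σ₁) (p, q)).1 ((g.2 : (PV σ₂) ≃ₗ[ℝ] PV σ₂) (0, 0)).1,
        Sum.elim ((g.1 : (PV σ₁) ≃ₗ[ℝ] PV σ₁) (p, q)).2 ((g.2 : (PV σ₂) ≃ₗ[ℝ] PV σ₂) (0, 0)).2) := by
  rw [coe_spBlock, Literature.NumberTheory.Automorphic.UnitaryGroup.spSumEquiv_apply]
  simp only [Sum.elim_comp_inl, Sum.elim_comp_inr]

omit [DecidableEq σ₁] [DecidableEq σ₂] in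
/-- `g₁ ⊕ g₂` on a vector supported in the second summand. [folklore] -/
private theorem spBlock_apply_inr (g : (SpR σ₁) × (SpR σ₂)) (p q : σ₂ → ℝ) :
    ((spBlock g : SpR (σ₁ ⊕ σ₂)) : (PV (σ₁ ⊕ σ₂)) ≃ₗ[ℝ] PV (σ₁ ⊕ σ₂)) (Sum.elim 0 p, Sum.elim 0 q) =
      (Sum.elim ((g.1 : (PV σ₁) ≃ₗ[ℝ] PV σ₁) (0, 0)).1 ((g.2 : (PV σ₂) ≃ₗ[ℝ] PV σ₂) (p, q)).1,
        Sum.elim ((g.1 : (PV σ₁) ≃ₗ[ℝ] PV σ₁) (0, 0)).2 ((g.2 : (PV σ₂) ≃ₗ[ℝ] PV σ₂) (p, q)).2) := by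
  rw [coe_spBlock, Literature.NumberTheory.Automorphic.UnitaryGroup.spSumEquiv_apply]
  simp only [Sum.elim_comp_inl, Sum.elim_comp_inr]

omit [Fintype σ₁] [Fintype σ₂] in
/-- `Pi.single (inl j) 1 = Sum.elim (Pi.single j 1) 0` on `σ₁ ⊕ σ₂`. [folklore] -/
private theorem single_inl_eq (j : σ₁) :
    (Pi.single (Sum.inl j) (1 : ℝ) : σ₁ ⊕ σ₂ → ℝ) = Sum.elim (Pi.single j (1 : ℝ)) (0 : σ₂ → ℝ) := by
  ext k
  rcases k with k | k
  · simp [Pi.single_apply]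
  · simp

omit [Fintype σ₁] [Fintype σ₂] in
/-- `Pi.single (inr j) 1 = Sum.elim 0 (Pi.single j 1)` on `σ₁ ⊕ σ₂`. [folklore] -/
private theorem single_inr_eq (j : σ₂) :
    (Pi.single (Sum.inr j) (1 : ℝ) : σ₁ ⊕ σ₂ → ℝ) = Sum.elim (0 : σ₁ → ℝ) (Pi.single j (1 : ℝ)) := by
  ext k
  rcases k with k | k
  · simp
  · simp [Pi.single_apply]

/-- **Folland's block over a block sum is block-diagonal: `P(g₁ ⊕ g₂) = P(g₁) ⊕ P(g₂)`** (the four real blocks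
`A, B, C, D` of `g₁ ⊕ g₂` are the block sums of those of `g₁`, `g₂`). [cite: Folland1989, §4.1 (4.11)–(4.16)] -/
theorem follandP_spBlock (g₁ : SpR σ₁) (g₂ : SpR σ₂) :
    follandP (spBlock (g₁, g₂)) = Matrix.fromBlocks (follandP g₁) 0 0 (follandP g₂) := by
  ext i j
  rcases i with i | i <;> rcases j with j | j
  · simp only [follandP, Matrix.smul_apply, Matrix.add_apply, RingHom.mapMatrix_apply, Matrix.map_apply,
      LinearMap.toMatrix'_apply, LinearMap.add_apply, LinearMap.sub_apply, Pi.add_apply, Pi.sub_apply,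
      blockA_apply, blockB_apply, blockC_apply, blockD_apply, Matrix.fromBlocks_apply₁₁, single_inl_eq]
    rw [show ((0 : σ₁ ⊕ σ₂ → ℝ)) = Sum.elim (0 : σ₁ → ℝ) (0 : σ₂ → ℝ) from (Sum.elim_zero_zero).symm,
      spBlock_apply_inl, spBlock_apply_inl]
    simp only [Sum.elim_inl]
  · simp only [follandP, Matrix.smul_apply, Matrix.add_apply, RingHom.mapMatrix_apply, Matrix.map_apply,
      LinearMap.toMatrix'_apply, LinearMap.add_apply, LinearMap.sub_apply, Pi.add_apply, Pi.sub_apply,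
      blockA_apply, blockB_apply, blockC_apply, blockD_apply, Matrix.fromBlocks_apply₁₂, single_inr_eq]
    rw [show ((0 : σ₁ ⊕ σ₂ → ℝ)) = Sum.elim (0 : σ₁ → ℝ) (0 : σ₂ → ℝ) from (Sum.elim_zero_zero).symm,
      spBlock_apply_inr, spBlock_apply_inr]
    simp only [Sum.elim_inl, Prod.mk_zero_zero, map_zero, Prod.fst_zero, Prod.snd_zero, Pi.zero_apply,
      Matrix.zero_apply]
    simp
  · simp only [follandP, Matrix.smul_apply, Matrix.add_apply, RingHom.mapMatrix_apply, Matrix.map_apply,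
      LinearMap.toMatrix'_apply, LinearMap.add_apply, LinearMap.sub_apply, Pi.add_apply, Pi.sub_apply,
      blockA_apply, blockB_apply, blockC_apply, blockD_apply, Matrix.fromBlocks_apply₂₁, single_inl_eq]
    rw [show ((0 : σ₁ ⊕ σ₂ → ℝ)) = Sum.elim (0 : σ₁ → ℝ) (0 : σ₂ → ℝ) from (Sum.elim_zero_zero).symm,
      spBlock_apply_inl, spBlock_apply_inl]
    simp only [Sum.elim_inr, Prod.mk_zero_zero, map_zero, Prod.fst_zero, Prod.snd_zero, Pi.zero_apply,
      Matrix.zero_apply]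
    simp
  · simp only [follandP, Matrix.smul_apply, Matrix.add_apply, RingHom.mapMatrix_apply, Matrix.map_apply,
      LinearMap.toMatrix'_apply, LinearMap.add_apply, LinearMap.sub_apply, Pi.add_apply, Pi.sub_apply,
      blockA_apply, blockB_apply, blockC_apply, blockD_apply, Matrix.fromBlocks_apply₂₂, single_inr_eq]
    rw [show ((0 : σ₁ ⊕ σ₂ → ℝ)) = Sum.elim (0 : σ₁ → ℝ) (0 : σ₂ → ℝ) from (Sum.elim_zero_zero).symm,
      spBlock_apply_inr, spBlock_apply_inr]
    simp only [Sum.elim_inr]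

/-- **`det P(g₁ ⊕ g₂) = det P(g₁) · det P(g₂)`.** [cite: Folland1989, §4.1 (4.11)–(4.16)] -/
theorem det_follandP_spBlock (g₁ : SpR σ₁) (g₂ : SpR σ₂) :
    (follandP (spBlock (g₁, g₂))).det = (follandP g₁).det * (follandP g₂).det := by
  rw [follandP_spBlock, Matrix.det_fromBlocks_zero₂₁]

end Sp

/-! ## 4. Folland's normalisation is multiplicative -/

namespace MpS

/-- **`x₁, x₂` metaplectic ⟹ `x₁ ⊠ x₂` metaplectic**: `C(x₁ ⊠ x₂)² det P(g₁ ⊕ g₂) = (C(x₁)² det P(g₁)) (C(x₂)² det P(g₂))`.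
So `⊠` restricts to `Mp₂(W₁) × Mp₂(W₂) → Mp₂(W₁ ⊕ W₂)`. [cite: MoeglinVignerasWaldspurger1987, Chap. 2 II.1 (6); Folland1989, Thm. (4.37)] -/
theorem IsMetaplectic.tensor {x₁ : MpS σ₁} {x₂ : MpS σ₂} (h₁ : IsMetaplectic x₁) (h₂ : IsMetaplectic x₂) :
    IsMetaplectic (MpS.tensor x₁ x₂) := by
  have e₁ : vac x₁ ^ 2 * (Sp.follandP (proj x₁)).det = 1 := h₁
  have e₂ : vac x₂ ^ 2 * (Sp.follandP (proj x₂)).det = 1 := h₂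
  show vac (MpS.tensor x₁ x₂) ^ 2 * (Sp.follandP (proj (MpS.tensor x₁ x₂))).det = 1
  rw [vac_tensor, proj_tensor, Sp.det_follandP_spBlock]
  linear_combination (vac x₂ ^ 2 * (Sp.follandP (proj x₂)).det) * e₁ + e₂

/-- **Conversely, a metaplectic element over `proj x₁ ⊕ proj x₂` is `±(x₁ ⊠ x₂)`** (`x₁, x₂` metaplectic): the fibre
of `Mp₂(W₁ ⊕ W₂)` over the block-diagonal subgroup is reached by `⊠`. [cite: MoeglinVignerasWaldspurger1987, Chap. 2 II.1 (6); Folland1989, Thm. (4.37)] -/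
theorem IsMetaplectic.eq_tensor_or {x₁ : MpS σ₁} {x₂ : MpS σ₂} {y : MpS (σ₁ ⊕ σ₂)} (h₁ : IsMetaplectic x₁)
    (h₂ : IsMetaplectic x₂) (hy : IsMetaplectic y) (hproj : proj y = spBlock (proj x₁, proj x₂)) :
    y = MpS.tensor x₁ x₂ ∨ y = negOne * MpS.tensor x₁ x₂ :=
  (h₁.tensor h₂).eq_or_eq_negOne_mul hy (by rw [proj_tensor, hproj])

/-- Without normalisation: ANY element of `Mp^𝓢(W₁ ⊕ W₂)` over `proj x₁ ⊕ proj x₂` is a unimodular multiple of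
`x₁ ⊠ x₂` (Schur). [cite: Folland1989, Prop. (1.43), §4.2 (4.23)] -/
theorem exists_unitSmul_tensor_of_proj_eq (x₁ : MpS σ₁) (x₂ : MpS σ₂) {y : MpS (σ₁ ⊕ σ₂)}
    (hproj : proj y = spBlock (proj x₁, proj x₂)) :
    ∃ c : ℂ, ‖c‖ = 1 ∧ ∀ F : SR (σ₁ ⊕ σ₂), y.1.2 F = c • (tensor x₁ x₂).1.2 F :=
  exists_unitSmul_of_proj_eq (by rw [proj_tensor, hproj])

/-! ## 5. The diagonal: the tensor square is canonical -/

variable {σ : Type*} [Fintype σ] [DecidableEq σ]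

/-- **The tensor square forgets the sign: `(−x) ⊠ (−x) = x ⊠ x`.**  Over the diagonal `g ↦ g ⊕ g` the two metaplectic
elements `±x` over `g` have the SAME tensor square, a canonical point of `Mp₂(W ⊕ W)` over `g ⊕ g`.
[cite: MoeglinVignerasWaldspurger1987, Chap. 2 II.1 (6)] -/
theorem tensor_negOne_mul_self (x : MpS σ) : tensor (negOne * x) (negOne * x) = tensor x x :=
  tensor_negOne_mul_negOne_mul x x

/-- **The canonical point is multiplicative**: if `z = x y` or `z = −(x y)` (the two possibilities for metaplectic
elements, `IsMetaplectic.eq_or_eq_negOne_mul` with R2) then `z ⊠ z = (x ⊠ x)(y ⊠ y)` — the metaplectic cover restricted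
to the diagonal `Sp(W) → Sp(W ⊕ W)` SPLITS, canonically. [cite: MoeglinVignerasWaldspurger1987, Chap. 2 II.1 (6)] -/
theorem tensorSq_mul_of {x y z : MpS σ} (h : z = x * y ∨ z = negOne * (x * y)) :
    tensor z z = tensor x x * tensor y y := by
  rcases h with rfl | rfl
  · exact tensor_mul x y x y
  · rw [tensor_negOne_mul_self, tensor_mul]

/-- The tensor square of a metaplectic element is metaplectic. [cite: Folland1989, Thm. (4.37)] -/
theorem IsMetaplectic.tensorSq {x : MpS σ} (h : IsMetaplectic x) : IsMetaplectic (MpS.tensor x x) := h.tensor h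

end MpS

end Literature.NumberTheory.Weil1964

end
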